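import Mathlib
import HarnessLib
import Summits.QuantumFields.YangMills.Theses.FradkinShenkerFlow
import Summits.QuantumFields.YangMills.Theses.EquipartitionCriticality
import Summits.QuantumFields.YangMills.Theses.DirichletWindow

/-!
# Sketch — crux `ClusteringToYangMills` (stmt-QuantumFields-9443), crux-ideate round 1, ideator 1

First lemmas of the two idea cards, stated over existing declarations, plus the CERTIFIED DOCK:
`dock` proves, by pure logic, that the crux follows from ONE new adapter statement
(`TorusGapUniformisation`: re-quantise H's `∃ m ∀ A B ∃ C` torus clustering into the β-uniform
`LatticeGapLargeBeta` form) together with three items that already exist on sibling routes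
(`DirichletWindow.XiDiverges`, `DirichletWindow.CriticalityOfXiDiverges`,
`EquipartitionCriticality.CriticalContinuumLimit`).
-/

open scoped BigOperators Topology ENNReal
open MeasureTheory Filter
open Literature.MathematicalPhysics.QuantumFieldTheory Literature.MathematicalPhysics.QuantumLattice

namespace Summit.QuantumFields.YangMills.Cruxes.ClusteringToYangMills.Sketch

/-- H of the crux, for one `(G, r)`: volume-uniform exponential clustering in Euclidean time on
the symmetric tori at every `β ≥ β₀`, with a rate `m(β)` and constants `C(A,B,β)` (the exact
antecedent of `FradkinShenkerFlow.ClusteringToYangMills`, per group and representation). -/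
def TorusClusteringH (G : Type) [Group G] [TopologicalSpace G] [IsTopologicalGroup G]
    [CompactSpace G] [MeasurableSpace G] [BorelSpace G] (r : LatticeRep G) : Prop :=
  ∃ β₀ : ℝ, ∀ β : ℝ, β₀ ≤ β → (∃ m : ℝ, 0 < m ∧ ∀ A B : YMSpecies G, ∃ C : ℝ, ∀ S n : ℕ, n ≤ S →
    |latticeConnectedCorr r.ρ β (2 * S + 1) A.F B.F n| ≤ C * Real.exp (-(m * n)))

/-- The β-UNIFORM, large-torus form consumed by `EquipartitionCriticality.LatticeGapLargeBeta` /
`CriticalContinuumLimit` (hypothesis 1): one rate function `m(β) > 0`, a torus threshold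
`S₀(β)`, and constants `C(A,B)` that do NOT depend on `β`. -/
def UniformTorusGap (G : Type) [Group G] [TopologicalSpace G] [IsTopologicalGroup G]
    [CompactSpace G] [MeasurableSpace G] [BorelSpace G] (r : LatticeRep G) : Prop :=
  ∃ (β₁ : ℝ) (m : ℝ → ℝ) (S₀ : ℝ → ℕ), (∀ β : ℝ, β₁ ≤ β → 0 < m β) ∧
    ∀ A B : YMSpecies G, ∃ C : ℝ, ∀ β : ℝ, β₁ ≤ β → ∀ S n : ℕ, S₀ β ≤ S → n ≤ S →
      |latticeConnectedCorr r.ρ β (2 * S + 1) A.F B.F n| ≤ C * Real.exp (-(m β * n))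

/-- **Card 1, first lemma (the adapter = the one new stub of the docking line).**
TORUS GAP UNIFORMISATION: H ⇒ the β-uniform large-torus form. Content: (i) infinite volume —
OS/RP spectral re-quantisation upgrades any exponential bound to the TRUE gap `m_∞(β)` with
OS-norm constants `2‖A‖‖B‖e^{m w}` (free); (ii) tori `S ≥ S₀(β)` — transfer-matrix block
decomposition, whose thermal block needs the thermal multiplicity of the spatial 3-torus at
aspect ratio 1/2 and the spatial-torus gap `m_V ≥ m_∞/2` (open: the "torus clause is thermal"). -/
def TorusGapUniformisation : Prop :=
  ∀ (G : Type) [Group G] [TopologicalSpace G] [IsTopologicalGroup G] [CompactSpace G]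
    [MeasurableSpace G] [BorelSpace G], IsCompactSimpleLieGroup G → ∀ r : LatticeRep G,
    TorusClusteringH G r → UniformTorusGap G r

/-- **CERTIFIED DOCK (pure logic, no sorry).** The crux `ClusteringToYangMills` follows from the
adapter and three existing sibling items: criticality of every admissible rate
(`CriticalityOfXiDiverges` fed by `XiDiverges`) and the continuum/OS leg
`CriticalContinuumLimit` (stmt-QuantumFields-8762). -/
theorem dock (hU : TorusGapUniformisation)
    (hXi : Theses.DirichletWindow.XiDiverges)
    (hCrit : Theses.DirichletWindow.CriticalityOfXiDiverges)
    (hCCL : Theses.EquipartitionCriticality.CriticalContinuumLimit) :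
    Theses.FradkinShenkerFlow.ClusteringToYangMills := by
  intro hH G _ _ _ _ hG
  letI : MeasurableSpace G := borel G
  haveI : BorelSpace G := ⟨rfl⟩
  have h1 : ∀ r : LatticeRep G, UniformTorusGap G r := fun r => hU G hG r (hH G hG r)
  exact hCCL G hG h1 (hCrit hXi G hG)

/-- **Card 1, support lemma (provable now): spectral re-quantisation.** A finite measure on
`[0,1]` whose moments are `O(e^{-mn})` is supported in `[0, e^{-m}]` — the one-line reason why,
in the infinite-volume RP state, ANY exponential clustering bound upgrades to the true
transfer-matrix gap with OS-norm constants. -/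
def MomentSupportBound : Prop :=
  ∀ (ν : Measure ℝ) [IsFiniteMeasure ν] (m C : ℝ), 0 < m →
    ν (Set.Icc 0 1)ᶜ = 0 →
    (∀ n : ℕ, ∫ t, t ^ n ∂ν ≤ C * Real.exp (-(m * n))) →
      ν (Set.Ioc (Real.exp (-m)) 1) = 0

/-- **Card 1, the thermal block in abstract form (provable now, finite-dimensional linear
algebra).** For weights `x_i ∈ [0, e^{-μ}]` (`i ≥ 1`; ratios `λ_i/λ_0` of a positive transfer
matrix) and a matrix `w` with row sums `≤ W`, the off-vacuum block of the period-`N` torus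
two-point function at separation `n` obeys
`Σ_{i,j} w_ij x_i^{N-n} x_j^n ≤ W e^{-μ n} Σ_i x_i^{N-n}` — decay at the spatial-torus gap times the
THERMAL MULTIPLICITY at the complementary period `N - n ≥ N/2`: the torus clause costs exactly a
dilute-gas bound at aspect ratio 1/2. -/
def ThermalBlockBound : Prop :=
  ∀ (k : ℕ) (x : Fin k → ℝ) (w : Fin k → Fin k → ℝ) (μ W : ℝ) (N n : ℕ), n ≤ N →
    (∀ i, 0 ≤ x i ∧ x i ≤ Real.exp (-μ)) → (∀ i j, 0 ≤ w i j) → (∀ i, ∑ j, w i j ≤ W) →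
      ∑ i, ∑ j, w i j * x i ^ (N - n) * x j ^ n ≤ W * Real.exp (-(μ * n)) * ∑ i, x i ^ (N - n)

/-- **Card 2, first lemma (a): RP subadditivity of the symmetric-torus free energy under doubling
(provable from positivity of the Wilson transfer matrix in each of the four directions:
`Tr T^{2M} ≤ (Tr T^M)^2`, applied once per direction).** With the tree's normalised Haar measure
`Z(β = 0) = 1`, so the DOUBLING DEFECT `log Z_L - (1/16) log Z_{2L} ≥ 0` vanishes at `β = 0`. -/
def DoublingSubadditivity : Prop :=
  ∀ (G : Type) [Group G] [TopologicalSpace G] [IsTopologicalGroup G] [CompactSpace G]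
    [MeasurableSpace G] [BorelSpace G] (r : LatticeRep G) (β : ℝ), 0 ≤ β → ∀ L : ℕ, (hL : 1 ≤ L) →
    haveI : NeZero L := ⟨Nat.one_le_iff_ne_zero.mp hL⟩
    haveI : NeZero (2 * L) := ⟨mul_ne_zero two_ne_zero (Nat.one_le_iff_ne_zero.mp hL)⟩
    partitionFunction (d := 4) (L := 2 * L) r.ρ β ≤ (partitionFunction (d := 4) (L := L) r.ρ β) ^ 16

/-- **Card 2, first lemma (b): thermodynamic integration of the doubling defect (provable now:
`d/dβ log Z_L = Σ_p ⟨Re tr ρ(U_p)⟩_{L,β}`, `6 L^4` plaquettes, `Z_L(0) = 1`).** The doubling defect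
at `β` equals the coupling-integrated finite-size SHIFT of the plaquette between the tori of
sides `L` and `2L`: a density-of-states quantity becomes a one-point function. -/
def DoublingDefectIntegral : Prop :=
  ∀ (G : Type) [Group G] [TopologicalSpace G] [IsTopologicalGroup G] [CompactSpace G]
    [MeasurableSpace G] [BorelSpace G] (r : LatticeRep G) (β : ℝ), 0 ≤ β → ∀ L : ℕ, (hL : 1 ≤ L) →
    haveI : NeZero L := ⟨Nat.one_le_iff_ne_zero.mp hL⟩
    haveI : NeZero (2 * L) := ⟨mul_ne_zero two_ne_zero (Nat.one_le_iff_ne_zero.mp hL)⟩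
    Real.log (partitionFunction (d := 4) (L := L) r.ρ β).toReal
        - (1 / 16) * Real.log (partitionFunction (d := 4) (L := 2 * L) r.ρ β).toReal
      = 6 * (L : ℝ) ^ 4 * ∫ b in (0 : ℝ)..β,
          (wilsonExpectation (d := 4) (L := L) r.ρ b (fun U => (r.ρ (plaquetteHolonomy U 0 0 1)).trace.re)
            - wilsonExpectation (d := 4) (L := 2 * L) r.ρ b (fun U => (r.ρ (plaquetteHolonomy U 0 0 1)).trace.re))

end Summit.QuantumFields.YangMills.Cruxes.ClusteringToYangMills.Sketch
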